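import Summits.NavierStokesRegularity.NavierStokesRegularity.Theorems.TypeILiouvilleTypeIliouvilleNoTypeIINormalForm
import HarnessLib

/-!
# Hard core `NoTypeII` (stmt-NavierStokesRegularity-0056): the door calculus AT UNIT SCALE

With the normal form `typeIliouvilleNoTypeII_iff_unit` (`…NormalForm.lean`: `NoTypeII` ↔ its instance
`ν = 1`, `T = 1`), the three obligations of the Type-II-side door calculus
(`Theorems/TypeILiouvilleTypeIliouvilleNoTypeIIDoorCalculus.lean`) for a candidate clause need only be
supplied AT UNIT SCALE — a clause `D u p` on maximal smooth unit-viscosity solutions on `[0, 1)`,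
Leray–Hopf from a rapidly decaying datum:

* `typeIliouvilleNoTypeII_of_unitClause_of_kill` — CLOSES-GLUE: (∀ unit blow-ups, D) ∧ KILL₁ ⊢ NoTypeII;
* `unitClause_of_typeIliouvilleNoTypeII_of_necessary` — NECESSARY₁ ⊢ NoTypeII ⇒ (∀ unit blow-ups, D);
* `unitClause_iff_typeIliouvilleNoTypeII` — TAUTOLOGY CERTIFICATE at unit scale: KILL₁ ∧ NECESSARY₁ ⊢
  (∀ unit blow-ups, D) ↔ NoTypeII (the critics' K2-by-name test without `(ν, T)` bookkeeping);
* `unitClause_iff_typeIliouvilleNoTypeII_and_typeIResidue` — LOCATION at unit scale.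

WHAT THIS IS NOT: not NS; implications between OPEN statements. [folklore]
-/

noncomputable section

-- the summit and its single problem share the name (D-0017 nested layout)
set_option linter.dupNamespace false

open MeasureTheory Set Function Filter TopologicalSpace Metric
open scoped Topology NNReal ENNReal

namespace Summit.NavierStokesRegularity.NavierStokesRegularity.Theorems.TypeIliouvilleNoTypeII.EternalSplit

open Literature.Analysis Literature.Analysis.FluidPDE
open Summit.NavierStokesRegularity.NavierStokesRegularity.Theses.TypeILiouville (TypeIliouvilleNoTypeII)

variable {D : (ℝ → EuclideanSpace ℝ (Fin 3) → EuclideanSpace ℝ (Fin 3)) →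
  (ℝ → EuclideanSpace ℝ (Fin 3) → ℝ) → Prop}

/-- **CLOSES-GLUE at unit scale.** If the clause `D` holds for every maximal smooth unit-viscosity
solution on `[0, 1)`, Leray–Hopf from a rapidly decaying datum, and forces the Type-I rate at `1` on such
solutions, then `NoTypeII`. [folklore] -/
theorem typeIliouvilleNoTypeII_of_unitClause_of_kill
    (hD : ∀ (u : ℝ → EuclideanSpace ℝ (Fin 3) → EuclideanSpace ℝ (Fin 3))
      (p : ℝ → EuclideanSpace ℝ (Fin 3) → ℝ),
      IsMaximalSmoothSolution 1 0 u p 1 → IsLerayHopfOn 1 1 0 (u 0) u → HasRapidSpatialDecay (u 0) →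
      D u p)
    (hkill : ∀ (u : ℝ → EuclideanSpace ℝ (Fin 3) → EuclideanSpace ℝ (Fin 3))
      (p : ℝ → EuclideanSpace ℝ (Fin 3) → ℝ),
      IsMaximalSmoothSolution 1 0 u p 1 → IsLerayHopfOn 1 1 0 (u 0) u → HasRapidSpatialDecay (u 0) →
      D u p → IsTypeIBlowup u 1) :
    TypeIliouvilleNoTypeII :=
  typeIliouvilleNoTypeII_iff_unit.2 fun u p hmax hLH hdec =>
    hkill u p hmax hLH hdec (hD u p hmax hLH hdec)

/-- **NECESSARY₁ ⊢ NoTypeII ⇒ (∀ unit blow-ups, D).** [folklore] -/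
theorem unitClause_of_typeIliouvilleNoTypeII_of_necessary (hII : TypeIliouvilleNoTypeII)
    (hnec : ∀ (u : ℝ → EuclideanSpace ℝ (Fin 3) → EuclideanSpace ℝ (Fin 3))
      (p : ℝ → EuclideanSpace ℝ (Fin 3) → ℝ),
      IsMaximalSmoothSolution 1 0 u p 1 → IsLerayHopfOn 1 1 0 (u 0) u → HasRapidSpatialDecay (u 0) →
      IsTypeIBlowup u 1 → D u p) :
    ∀ (u : ℝ → EuclideanSpace ℝ (Fin 3) → EuclideanSpace ℝ (Fin 3))
      (p : ℝ → EuclideanSpace ℝ (Fin 3) → ℝ),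
      IsMaximalSmoothSolution 1 0 u p 1 → IsLerayHopfOn 1 1 0 (u 0) u → HasRapidSpatialDecay (u 0) →
      D u p :=
  fun u p hmax hLH hdec => hnec u p hmax hLH hdec (hII 1 1 one_pos one_pos u p hmax hLH hdec)

/-- **TAUTOLOGY CERTIFICATE at unit scale.** KILL₁ ∧ NECESSARY₁ ⊢ (∀ unit blow-ups, D) ↔ NoTypeII:
a candidate whose unit-scale clause is both forced by and forcing the Type-I rate restates the hard
core. [folklore] -/
theorem unitClause_iff_typeIliouvilleNoTypeII
    (hkill : ∀ (u : ℝ → EuclideanSpace ℝ (Fin 3) → EuclideanSpace ℝ (Fin 3))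
      (p : ℝ → EuclideanSpace ℝ (Fin 3) → ℝ),
      IsMaximalSmoothSolution 1 0 u p 1 → IsLerayHopfOn 1 1 0 (u 0) u → HasRapidSpatialDecay (u 0) →
      D u p → IsTypeIBlowup u 1)
    (hnec : ∀ (u : ℝ → EuclideanSpace ℝ (Fin 3) → EuclideanSpace ℝ (Fin 3))
      (p : ℝ → EuclideanSpace ℝ (Fin 3) → ℝ),
      IsMaximalSmoothSolution 1 0 u p 1 → IsLerayHopfOn 1 1 0 (u 0) u → HasRapidSpatialDecay (u 0) →
      IsTypeIBlowup u 1 → D u p) :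
    (∀ (u : ℝ → EuclideanSpace ℝ (Fin 3) → EuclideanSpace ℝ (Fin 3))
      (p : ℝ → EuclideanSpace ℝ (Fin 3) → ℝ),
      IsMaximalSmoothSolution 1 0 u p 1 → IsLerayHopfOn 1 1 0 (u 0) u → HasRapidSpatialDecay (u 0) →
      D u p) ↔ TypeIliouvilleNoTypeII :=
  ⟨fun hD => typeIliouvilleNoTypeII_of_unitClause_of_kill hD hkill,
    fun hII => unitClause_of_typeIliouvilleNoTypeII_of_necessary hII hnec⟩

/-- **LOCATION at unit scale.** KILL₁ ⊢ (∀ unit blow-ups, D) ↔ NoTypeII ∧ (∀ unit Type-I blow-ups, D):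
the content of a unit-scale candidate beyond the hard core sits on unit Type-I blow-ups. [folklore] -/
theorem unitClause_iff_typeIliouvilleNoTypeII_and_typeIResidue
    (hkill : ∀ (u : ℝ → EuclideanSpace ℝ (Fin 3) → EuclideanSpace ℝ (Fin 3))
      (p : ℝ → EuclideanSpace ℝ (Fin 3) → ℝ),
      IsMaximalSmoothSolution 1 0 u p 1 → IsLerayHopfOn 1 1 0 (u 0) u → HasRapidSpatialDecay (u 0) →
      D u p → IsTypeIBlowup u 1) :
    (∀ (u : ℝ → EuclideanSpace ℝ (Fin 3) → EuclideanSpace ℝ (Fin 3))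
      (p : ℝ → EuclideanSpace ℝ (Fin 3) → ℝ),
      IsMaximalSmoothSolution 1 0 u p 1 → IsLerayHopfOn 1 1 0 (u 0) u → HasRapidSpatialDecay (u 0) →
      D u p) ↔
    TypeIliouvilleNoTypeII ∧
      (∀ (u : ℝ → EuclideanSpace ℝ (Fin 3) → EuclideanSpace ℝ (Fin 3))
        (p : ℝ → EuclideanSpace ℝ (Fin 3) → ℝ),
        IsMaximalSmoothSolution 1 0 u p 1 → IsLerayHopfOn 1 1 0 (u 0) u → HasRapidSpatialDecay (u 0) →
        IsTypeIBlowup u 1 → D u p) :=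
  ⟨fun hD => ⟨typeIliouvilleNoTypeII_of_unitClause_of_kill hD hkill,
      fun u p hmax hLH hdec _ => hD u p hmax hLH hdec⟩,
    fun h => unitClause_of_typeIliouvilleNoTypeII_of_necessary h.1 h.2⟩

end Summit.NavierStokesRegularity.NavierStokesRegularity.Theorems.TypeIliouvilleNoTypeII.EternalSplit

end
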